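import Summits.FinalStateConjecture.FinalStateConjecture.Theorems.ClusterCompletenessOmegaLimitMultiKerrTranslateCompactness
import HarnessLib

/-!
# Route ClusterCompleteness · crux `OmegaLimitMultiKerr` — all `C^{k+1}_loc` ω-limits stationary
# ⇒ the development is asymptotically stationary in era gauge

Structure lemma for the crux stmt-FinalStateConjecture-14664 (`ClusterCompleteness.OmegaLimitMultiKerr`),
line `Sketch` (LaSalle reading of the recurrence clause). The late-time TRANSLATES
`x ↦ h (x + t • e)` of a chart field `h` (`C^{k+2}` on an open domain `O ⊆ E` invariant under
translation by the Killing direction `e`) have `C^{k+1}_loc` ω-limits under tameness (all-late-time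
`C^{k+2}` bounds on compacts); the transfer inequality for a definite flux makes every ω-limit `g`
STATIONARY, `∂ₑ g = 0` on `O`. This file is the converse bookkeeping turning "all ω-limits are
stationary" into a statement about the development itself:

**Theorem (`tendsto_supCkENorm_fderiv_translate_of_omegaLimits_stationary`).** If `h` is tame and
every `C^{k+1}_loc` ω-limit `g` of its translates satisfies `∂ₑ g = 0` on `O`, then
`supCkENorm K k (∂ₑ h (· + t • e)) → 0` as `t → +∞` on every compact `K ⊆ O`
("asymptotically stationary in era gauge").

Proof: the subsequence principle (`Filter.tendsto_of_subseq_tendsto`) plus the `C^{k+1}`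
Arzelà–Ascoli theorem for translates (`exists_strictMono_tendsto_supCkENorm_translate_sub`): along
any `tₙ → +∞` a further subsequence of translates converges in `C^{k+1}_loc` to some `g` with
`∂ₑ g = 0`, and `∂ₑ` of the translate equals `∂ₑ` of (translate ` − g`), whose `Cᵏ` sup norm is at
most `‖e‖` times the `C^{k+1}` sup norm of the difference. This is the "solutions approach the
largest invariant subset" step of the LaSalle invariance principle, Hale 1980, Ch. X, §1, in the
`Cᵏ_loc` translation flow.
-/

-- every `Summit.FinalStateConjecture.FinalStateConjecture.…` name repeats the summit = sub-problem segment (D-0017 layout)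
set_option linter.dupNamespace false

noncomputable section

open Set Filter Topology Function
open scoped ContDiff Topology ENNReal

namespace Summit.FinalStateConjecture.FinalStateConjecture.Theorems.ClusterCompleteness

open Literature.Geometry.Lorentzian

section Bookkeeping

variable {E : Type*} [NormedAddCommGroup E] [NormedSpace ℝ E]
  {W : Type*} [NormedAddCommGroup W] [NormedSpace ℝ W]

/-- Evaluating the derivative at a fixed vector costs at most its norm: for `F` of class `Cⁿ` at
`x` and `m + 1 ≤ n`, `‖Dᵐ[y ↦ DF(y) e](x)‖ ≤ ‖e‖ · ‖D^{m+1} F(x)‖` (the map `y ↦ DF(y) e` is the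
composition of the continuous linear map "evaluate at `e`" with `DF`). [folklore] -/
private theorem norm_iteratedFDeriv_fderiv_apply_le_mul {F : E → W} {x : E} (e : E)
    {n : WithTop ℕ∞} {m : ℕ} (hF : ContDiffAt ℝ n F x) (hm : ((m + 1 : ℕ) : WithTop ℕ∞) ≤ n) :
    ‖iteratedFDeriv ℝ m (fun y ↦ fderiv ℝ F y e) x‖ ≤ ‖e‖ * ‖iteratedFDeriv ℝ (m + 1) F x‖ := by
  set L : (E →L[ℝ] W) →L[ℝ] W := ContinuousLinearMap.apply ℝ W e with hL
  have hfd : ContDiffAt ℝ m (fderiv ℝ F) x := hF.fderiv_right (by exact_mod_cast hm)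
  have hcomp : (fun y ↦ fderiv ℝ F y e) = L ∘ fderiv ℝ F := by
    funext y
    simp [hL]
  rw [hcomp, L.iteratedFDeriv_comp_left hfd le_rfl, ← norm_iteratedFDeriv_fderiv]
  refine (ContinuousLinearMap.norm_compContinuousMultilinearMap_le _ _).trans ?_
  gcongr
  refine ContinuousLinearMap.opNorm_le_bound _ (norm_nonneg _) fun f ↦ ?_
  rw [hL, ContinuousLinearMap.apply_apply, mul_comm]
  exact f.le_opNorm e

/-- **`∂ₑ f` is controlled in `Cᵏ` by `f − g` in `C^{k+1}` when `∂ₑ g = 0`.** For `f, g` of class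
`C^{k+1}` on an open set `O ⊇ K` with `∂ₑ g = 0` on `O`,
`‖∂ₑ f‖_{Cᵏ(K)} ≤ ‖e‖ · ‖f − g‖_{C^{k+1}(K)}`: indeed `∂ₑ f = ∂ₑ (f − g)` on `O`, and
`Dᵐ ∂ₑ (f − g) = (D^{m+1} (f − g)) (·, e)`. [folklore] -/
private theorem supCkENorm_fderiv_apply_le_of_fderiv_apply_eq_zero {O K : Set E} (hO : IsOpen O)
    (hKO : K ⊆ O) {k : ℕ} {f g : E → W} {e : E} (hf : ContDiffOn ℝ (k + 1) f O)
    (hg : ContDiffOn ℝ (k + 1) g O) (hstat : ∀ y ∈ O, fderiv ℝ g y e = 0) :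
    supCkENorm K k (fun x ↦ fderiv ℝ f x e) ≤
      ‖e‖ₑ * supCkENorm K (k + 1) (fun x ↦ f x - g x) := by
  refine supCkENorm_le_of_forall_le fun m hm x hx ↦ ?_
  have hxO : O ∈ 𝓝 x := hO.mem_nhds (hKO hx)
  have hk1 : ((k : WithTop ℕ∞) + 1) ≠ 0 := by exact_mod_cast (show k + 1 ≠ 0 by omega)
  have hFO : ContDiffOn ℝ (k + 1) (fun y ↦ f y - g y) O := hf.sub hg
  -- `∂ₑ f = ∂ₑ (f − g)` near `x`
  have heq : (fun y ↦ fderiv ℝ f y e) =ᶠ[𝓝 x] fun y ↦ fderiv ℝ (fun z ↦ f z - g z) y e := by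
    filter_upwards [hxO] with y hy
    have h1 : DifferentiableAt ℝ f y := (hf.contDiffAt (hO.mem_nhds hy)).differentiableAt hk1
    have h2 : DifferentiableAt ℝ g y := (hg.contDiffAt (hO.mem_nhds hy)).differentiableAt hk1
    rw [fderiv_fun_sub h1 h2]
    simp [hstat y hy]
  rw [(heq.iteratedFDeriv ℝ m).eq_of_nhds]
  have hm1 : ((m + 1 : ℕ) : WithTop ℕ∞) ≤ (k : WithTop ℕ∞) + 1 := by
    exact_mod_cast Nat.succ_le_succ hm
  calc ‖iteratedFDeriv ℝ m (fun y ↦ fderiv ℝ (fun z ↦ f z - g z) y e) x‖ₑ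
      ≤ ‖e‖ₑ * ‖iteratedFDeriv ℝ (m + 1) (fun z ↦ f z - g z) x‖ₑ := by
        rw [← ofReal_norm, ← ofReal_norm, ← ofReal_norm, ← ENNReal.ofReal_mul (norm_nonneg _)]
        exact ENNReal.ofReal_le_ofReal
          (norm_iteratedFDeriv_fderiv_apply_le_mul e (hFO.contDiffAt hxO) hm1)
    _ ≤ ‖e‖ₑ * supCkENorm K (k + 1) (fun z ↦ f z - g z) :=
        mul_le_mul_right (enorm_iteratedFDeriv_le_supCkENorm (by omega) hx _) _

end Bookkeeping

/-- **All `C^{k+1}_loc` ω-limits stationary ⇒ asymptotically stationary in era gauge** (the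
"solutions approach the largest invariant set" step of the LaSalle invariance principle,
Hale 1980, Ch. X, §1, for the translation flow `h ↦ h (· + t • e)` in the `Cᵏ_loc` topology). Let
`O ⊆ E` be open and invariant under `x ↦ x + s • e`; let `h` be `C^{k+2}` on `O` and tame (on each
compact `K ⊆ O` the derivatives of order `≤ k + 2` of `h` are bounded at all translates `z + t • e`,
`z ∈ K`, `t ≥ a`); and suppose every `C^{k+1}` field `g` on `O` which is a `C^{k+1}_loc` ω-limit of
the translates of `h` (`supCkENorm K (k + 1) (h (· + T n • e) − g) → 0` on compacts along some
`T n → +∞`) is stationary, `∂ₑ g = 0` on `O`. Then `∂ₑ` of the translates tends to `0` in `Cᵏ` on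
every compact subset of `O`: `supCkENorm K k (x ↦ Dh(x + t • e) e) → 0` as `t → +∞`. Subsequence
principle plus the `C^{k+1}` Arzelà–Ascoli theorem for translates
`exists_strictMono_tendsto_supCkENorm_translate_sub`, and the estimate
`‖∂ₑ f‖_{Cᵏ(K)} ≤ ‖e‖ · ‖f − g‖_{C^{k+1}(K)}` for `∂ₑ g = 0`. Stated in closed form (registered
structure stub of the crux stmt-FinalStateConjecture-14664). [cite: Hale1980, Ch. X §1] -/
theorem tendsto_supCkENorm_fderiv_translate_of_omegaLimits_stationary :
    ∀ {E : Type*} [NormedAddCommGroup E] [NormedSpace ℝ E] [FiniteDimensional ℝ E]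
      {W : Type*} [NormedAddCommGroup W] [NormedSpace ℝ W] [FiniteDimensional ℝ W]
      {O : Set E} {e : E}, IsOpen O → (∀ x ∈ O, ∀ s : ℝ, x + s • e ∈ O) →
      ∀ {k : ℕ} {h : E → W}, ContDiffOn ℝ (k + 2) h O →
      (∀ K ⊆ O, IsCompact K → ∃ Λ a : ℝ, ∀ t : ℝ, a ≤ t → ∀ i, i ≤ k + 2 → ∀ z ∈ K,
        ‖iteratedFDeriv ℝ i h (z + t • e)‖ ≤ Λ) →
      (∀ (g : E → W) (T : ℕ → ℝ), ContDiffOn ℝ (k + 1) g O → Tendsto T atTop atTop →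
        (∀ K ⊆ O, IsCompact K →
          Tendsto (fun n ↦ supCkENorm K (k + 1) (fun x ↦ h (x + T n • e) - g x)) atTop (𝓝 0)) →
        ∀ y ∈ O, fderiv ℝ g y e = 0) →
      ∀ K ⊆ O, IsCompact K →
        Tendsto (fun t : ℝ ↦ supCkENorm K k (fun x ↦ fderiv ℝ h (x + t • e) e)) atTop (𝓝 0) := by
  intro E _ _ _ W _ _ _ O e hO hOe k h hh htame hstat K hKO hK
  refine tendsto_of_subseq_tendsto fun ns hns ↦ ?_
  -- nonnegative times `T n ≥ ns n`, equal to `ns n` once `ns n ≥ 0`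
  obtain ⟨T, hT0, hTge, hTeq⟩ : ∃ T : ℕ → ℝ, (∀ n, 0 ≤ T n) ∧ (∀ n, ns n ≤ T n) ∧
      ∀ n, 0 ≤ ns n → T n = ns n :=
    ⟨fun n ↦ max (ns n) 0, fun n ↦ le_max_right _ _, fun n ↦ le_max_left _ _,
      fun n hn ↦ max_eq_left hn⟩
  have hT : Tendsto T atTop atTop := tendsto_atTop_mono hTge hns
  have hOe' : ∀ x ∈ O, ∀ s : ℝ, 0 ≤ s → x + s • e ∈ O := fun x hx s _ ↦ hOe x hx s
  have hcast : ((k + 1 : ℕ) : WithTop ℕ∞) + 1 = (k : WithTop ℕ∞) + 2 := by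
    push_cast
    ring
  have hh' : ContDiffOn ℝ ((k + 1 : ℕ) + 1) h O := by
    rw [hcast]
    exact hh
  -- tameness gives eventual uniform `C^{k+2}` bounds along `T n → +∞`
  have hb : ∀ K ⊆ O, IsCompact K → ∃ Λ : ℝ, ∀ᶠ n in atTop, ∀ i, i ≤ k + 1 + 1 → ∀ z ∈ K,
      ‖iteratedFDeriv ℝ i h (z + T n • e)‖ ≤ Λ := by
    intro K' hK'O hK'
    obtain ⟨Λ, a, hΛ⟩ := htame K' hK'O hK'
    refine ⟨Λ, ?_⟩
    filter_upwards [hT.eventually_ge_atTop a] with n hn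
    intro i hi z hz
    exact hΛ (T n) hn i (by omega) z hz
  -- a `C^{k+1}_loc` ω-limit along a subsequence, stationary by hypothesis
  obtain ⟨g, φ, hφ, hg, hlim⟩ :=
    exists_strictMono_tendsto_supCkENorm_translate_sub (k := k + 1) hO hOe' hh' hT0 hb
  have hg' : ContDiffOn ℝ (k + 1) g O := by exact_mod_cast hg
  have hTφ : Tendsto (fun n ↦ T (φ n)) atTop atTop := hT.comp hφ.tendsto_atTop
  have hstat' : ∀ y ∈ O, fderiv ℝ g y e = 0 := hstat g (fun n ↦ T (φ n)) hg' hTφ hlim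
  -- the translates are `C^{k+1}` on `O`
  have htr : ∀ t : ℝ, ContDiffOn ℝ (k + 1) (fun x ↦ h (x + t • e)) O := by
    intro t
    have hk12 : ((k : WithTop ℕ∞) + 1) ≤ (k : WithTop ℕ∞) + 2 := by
      exact_mod_cast (show k + 1 ≤ k + 2 by omega)
    exact (hh.of_le hk12).comp (contDiff_id.add contDiff_const).contDiffOn
      fun x hx ↦ hOe x hx t
  -- `‖∂ₑ h (· + t • e)‖_{Cᵏ(K)} ≤ ‖e‖ · ‖h (· + t • e) − g‖_{C^{k+1}(K)}`
  have hbound : ∀ n, supCkENorm K k (fun x ↦ fderiv ℝ h (x + T (φ n) • e) e) ≤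
      ‖e‖ₑ * supCkENorm K (k + 1) (fun x ↦ h (x + T (φ n) • e) - g x) := by
    intro n
    have key := supCkENorm_fderiv_apply_le_of_fderiv_apply_eq_zero hO hKO (htr (T (φ n))) hg'
      hstat'
    simpa only [fderiv_comp_add_right] using key
  have hlim0 : Tendsto (fun n ↦ ‖e‖ₑ * supCkENorm K (k + 1) (fun x ↦ h (x + T (φ n) • e) - g x))
      atTop (𝓝 (‖e‖ₑ * 0)) :=
    ENNReal.Tendsto.const_mul (hlim K hKO hK) (Or.inr enorm_ne_top)
  rw [mul_zero] at hlim0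
  have hlimT : Tendsto (fun n ↦ supCkENorm K k (fun x ↦ fderiv ℝ h (x + T (φ n) • e) e))
      atTop (𝓝 0) :=
    tendsto_of_tendsto_of_tendsto_of_le_of_le tendsto_const_nhds hlim0 (fun _ ↦ zero_le) hbound
  refine ⟨φ, hlimT.congr' ?_⟩
  filter_upwards [hφ.tendsto_atTop.eventually (hns.eventually_ge_atTop 0)] with n hn
  rw [hTeq (φ n) hn]

end Summit.FinalStateConjecture.FinalStateConjecture.Theorems.ClusterCompleteness

end
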